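import Literature.NumberTheory.ConnesConsani2021.ArchDensityOfMajorant
import Mathlib.Analysis.SpecificLimits.Normed
import HarnessLib

/-!
# Connes–Consani 2021, §5 / App. F: the decay input `Σ |λ(n)|·n² < ∞` from an EVENTUAL majorant
# (the cell's shape of record for [Osipov 2013]) or from a geometric bound — bridges (PROVED)

RH-FREE corpus literature (label, line 1): three-line bookkeeping bridges between the shapes of the
one decay hypothesis of `ArchDensityOfMajorant.lean`; nothing in this file mentions `ζ`, the
critical strip or RH, and nothing here bears on the truth of RH.  bears_on (cell rh-crit, corpus
C1): apex input (B) — route «ConnesConsaniSemilocal» items K0 `DensityRegular` (stmt 19307) / K2.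

Source context: A. Connes, C. Consani, *Weil positivity and trace formula, the archimedean place*,
Selecta Math. (N.S.) 27 (2021) 77 = arXiv:2006.13771 [bib `ConnesConsani2021`], §4 p. 16
(rapid-decay) "all the further ones decay very fast to `0`"; the proved eventual bounds the cell
uses instead are [Osipov 2013] (typed by seat t15; shape of record cc R67 (3):
`∃ r, (∀ᶠ n, |λ(n)| ≤ r n) ∧ Σ r(n)·n² < ∞`).

What is here (all PROVED, no definition, no named fact): `summable_abs_mul_sq_of_eventually_le`
(eventual majorant ⇒ `Σ |λ(n)|·n² < ∞`), `summable_abs_mul_sq_of_eventually_le_geometric`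
(eventual `|λ(n)| ≤ C·qⁿ`, `0 ≤ q < 1`), and the capstones of `ArchDensityOfMajorant.lean` in the
eventual-majorant shape: `exists_contDiff_isArchDensity_of_eventually_le`,
`CC2021_lemma_5_4_of_eventually_le`, `CC2021_prop_5_3_of_eventually_le`,
`CC2021_rem_5_6_of_eventually_le`.

WHAT THIS IS NOT: no decay statement is proved here; nothing here bears on the truth of RH.
-/

noncomputable section

open Real Set Filter

namespace Literature.NumberTheory.ConnesConsani2021

open Literature.NumberTheory.LFunctions

/-- An eventual majorant summable against `n²` gives the decay input `Σ |λ(n)|·n² < ∞` of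
`ArchDensityOfMajorant.lean`.
[cite: ConnesConsani2021, §4 p. 16 eq. (rapid-decay) (arXiv chunk p0016:L36)] -/
theorem summable_abs_mul_sq_of_eventually_le {lam r : ℕ → ℝ}
    (hr : ∀ᶠ n in atTop, |lam n| ≤ r n) (hs : Summable (fun n ↦ r n * (n : ℝ) ^ 2)) :
    Summable (fun n ↦ |lam n| * (n : ℝ) ^ 2) := by
  refine Summable.of_norm_bounded_eventually_nat hs ?_
  filter_upwards [hr] with n hn
  rw [Real.norm_eq_abs, abs_mul, abs_abs, abs_of_nonneg (by positivity : (0:ℝ) ≤ (n : ℝ) ^ 2)]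
  exact mul_le_mul_of_nonneg_right hn (by positivity)

/-- An eventual GEOMETRIC bound `|λ(n)| ≤ C·qⁿ` (`0 ≤ q < 1`) gives the decay input
`Σ |λ(n)|·n² < ∞`. [cite: ConnesConsani2021, §4 p. 16 eq. (rapid-decay) (arXiv chunk p0016:L36)] -/
theorem summable_abs_mul_sq_of_eventually_le_geometric {lam : ℕ → ℝ} {C q : ℝ}
    (hq : 0 ≤ q) (hq1 : q < 1) (hr : ∀ᶠ n in atTop, |lam n| ≤ C * q ^ n) :
    Summable (fun n ↦ |lam n| * (n : ℝ) ^ 2) := by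
  have hg : Summable (fun n : ℕ ↦ (n : ℝ) ^ 2 * q ^ n) :=
    summable_pow_mul_geometric_of_norm_lt_one 2 (by rwa [Real.norm_eq_abs, abs_of_nonneg hq])
  refine summable_abs_mul_sq_of_eventually_le (r := fun n ↦ C * q ^ n) hr ?_
  have : (fun n : ℕ ↦ C * q ^ n * (n : ℝ) ^ 2) = fun n : ℕ ↦ C * ((n : ℝ) ^ 2 * q ^ n) := by
    funext n; ring
  rw [this]
  exact hg.mul_left C

/-- **K0 `DensityRegular` from an eventual eigenvalue majorant** (the cell's shape of record for the
decay input): `∃ G : ℝ → ℂ`, `C²`, an archimedean density, `= ε∘exp` on `[0,∞)`, slope `Σ' t(n)`,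
`G″(0) = 0`.
[cite: ConnesConsani2021, Prop. 5.3 §5 p. 32 (arXiv item Prop. 30); Lemma 5.4 pp. 32–33; App. F Lemma F.1 (arXiv Lemma 49)] -/
theorem exists_contDiff_isArchDensity_of_eventually_le
    (h : ∃ r : ℕ → ℝ, (∀ᶠ n in atTop, |prolateEigen n| ≤ r n) ∧
      Summable (fun n ↦ r n * (n : ℝ) ^ 2)) :
    ∃ G : ℝ → ℂ, ContDiff ℝ 2 G ∧ IsArchDensity G ∧ EqOn G (epsDensity prolateFun) (Ici 0) ∧
      deriv G 0 = ((∑' n, epsSlopeTerm (prolateFun n) : ℝ) : ℂ) ∧ deriv (deriv G) 0 = 0 := by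
  obtain ⟨r, hr, hs⟩ := h
  exact exists_contDiff_isArchDensity_of_summable (summable_abs_mul_sq_of_eventually_le hr hs)

/-- **Lemma 5.4 (`CC2021_lemma_5_4`) from an eventual eigenvalue majorant.**
[cite: ConnesConsani2021, Lemma 5.4 §5 pp. 32–33 (arXiv item Lemma 31, chunk p0020:L86–L101)] -/
theorem CC2021_lemma_5_4_of_eventually_le
    (h : ∃ r : ℕ → ℝ, (∀ᶠ n in atTop, |prolateEigen n| ≤ r n) ∧
      Summable (fun n ↦ r n * (n : ℝ) ^ 2)) : CC2021_lemma_5_4 := by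
  obtain ⟨r, hr, hs⟩ := h
  exact CC2021_lemma_5_4_of_summable (summable_abs_mul_sq_of_eventually_le hr hs)

/-- **Prop. 5.3 (`CC2021_prop_5_3`) from an eventual eigenvalue majorant.**
[cite: ConnesConsani2021, Prop. 5.3 eqs. (97)–(98) §5 p. 32 (arXiv item Prop. 30, chunk p0020:L59–L67)] -/
theorem CC2021_prop_5_3_of_eventually_le
    (h : ∃ r : ℕ → ℝ, (∀ᶠ n in atTop, |prolateEigen n| ≤ r n) ∧
      Summable (fun n ↦ r n * (n : ℝ) ^ 2)) : CC2021_prop_5_3 := by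
  obtain ⟨r, hr, hs⟩ := h
  exact CC2021_prop_5_3_of_summable (summable_abs_mul_sq_of_eventually_le hr hs)

/-- **Rem. 5.6 (`CC2021_rem_5_6`) from an eventual eigenvalue majorant.**
[cite: ConnesConsani2021, Rem. 5.6 §5 p. 34 (arXiv item Rem. 33, chunk p0021:L10)] -/
theorem CC2021_rem_5_6_of_eventually_le
    (h : ∃ r : ℕ → ℝ, (∀ᶠ n in atTop, |prolateEigen n| ≤ r n) ∧
      Summable (fun n ↦ r n * (n : ℝ) ^ 2)) : CC2021_rem_5_6 := by
  obtain ⟨r, hr, hs⟩ := h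
  exact CC2021_rem_5_6_of_summable (summable_abs_mul_sq_of_eventually_le hr hs)

end Literature.NumberTheory.ConnesConsani2021

end
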